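import Summits.AtomisticToContinuum.Crystallization.Theorems.PalmUnimodularRigidityLayeredLawsSelectHcpCorrBijection
import Mathlib.Algebra.BigOperators.Finprod

/-!
# Crux `LayeredLawsSelectHcp` (stmt-AtomisticToContinuum-9226), line `mtp-prestress-split-ergodic-frame`:
# the received mass of a directed corrector transport equals the plain chart sum

Registered sub-goal `tube_corrector_received_identity` of the crux item (lead c2, cycle 3; the combinatorial heart of
"directed orbit-sum correctors have zero mean").  Under the Mecke identity with the transport function
`g(μ, y) = ∑_{X ∈ RC(S), X c = y} φ (reRoot X c)`, the mass RECEIVED at the root is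
`∑_{y ∈ S} ∑_{Ψ ∈ RC(S − y), Ψ c = −y} φ (reRoot Ψ c)`; it equals `∑_{X ∈ RC(S)} φ X` because
`(y, Ψ) ↦ reRoot Ψ c` is a BIJECTION from `{(y, Ψ) : Ψ ∈ RC(S − y), Ψ c = −y}` onto `RC(S)` with inverse
`X ↦ (X ĉ, reRoot X ĉ)`, `ĉ = if Even c.1 then −c else c` (the pointwise identities `tube_reRoot_involution`,
`reRoot_involution'`, `reRoot_inv_apply`, `tube_reRoot_isRootedChart` are landed in `…CorrBijection` / `…ReRoot`).
This file does the finsum bookkeeping: the iterated sum is the sum over the (finite) graph of the fibres, which is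
re-indexed through the bijection (`finsum_mem_finset_product`, `finsum_mem_eq_of_bijOn`). [folklore]
-/

noncomputable section

namespace Summit.AtomisticToContinuum.Crystallization.Theorems.PalmUnimodularRigidity.LayeredLawsSelectHcp

open MeasureTheory Set
open Literature.MathematicalPhysics.StatisticalMechanics Literature.Geometry.DiscreteGeometry

/-- Translating back a translated set: `(· − (−y)) '' ((· − y) '' S) = S`. [folklore] -/
theorem image_sub_neg_image_sub (S : Set (EuclideanSpace ℝ (Fin 3))) (y : EuclideanSpace ℝ (Fin 3)) :
    (fun z : EuclideanSpace ℝ (Fin 3) => z - -y) '' ((fun z : EuclideanSpace ℝ (Fin 3) => z - y) '' S) = S := by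
  rw [image_image]
  simp [sub_neg_eq_add, sub_add_cancel]

/-- A rooted chart `Ψ` of `S − y` with `Ψ c = −y` re-roots at the label `c` to a rooted chart of `S` itself. [folklore] -/
theorem isRootedChart_reRoot_of_apply_eq_neg {S : Set (EuclideanSpace ℝ (Fin 3))} {y : EuclideanSpace ℝ (Fin 3)}
    {Ψ : ℤ × ℤ × ℤ → EuclideanSpace ℝ (Fin 3)}
    (hΨ : IsRootedChart ((fun z : EuclideanSpace ℝ (Fin 3) => z - y) '' S) Ψ) {c : ℤ × ℤ × ℤ} (hc : Ψ c = -y) :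
    IsRootedChart S (reRoot Ψ c) := by
  have h := tube_reRoot_isRootedChart _ Ψ hΨ c
  rwa [hc, image_sub_neg_image_sub] at h

/-- A rooted chart of `S − y` can only exist when `y ∈ S` (its root `Ψ 0 = 0` lies in `S − y`). [folklore] -/
theorem mem_of_isRootedChart_image_sub {S : Set (EuclideanSpace ℝ (Fin 3))} {y : EuclideanSpace ℝ (Fin 3)}
    {Ψ : ℤ × ℤ × ℤ → EuclideanSpace ℝ (Fin 3)}
    (hΨ : IsRootedChart ((fun z : EuclideanSpace ℝ (Fin 3) => z - y) '' S) Ψ) : y ∈ S := by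
  obtain ⟨z, hz, hz0⟩ := hΨ.2.1 0
  have hzy : z = y := sub_eq_zero.1 (hz0.trans hΨ.1)
  exact hzy ▸ hz

/-- **Registered sub-goal `tube_corrector_received_identity`.**  For a point set `S` with finitely many rooted charts, the
received mass `∑ᶠ_{y ∈ S} ∑ᶠ_{Ψ ∈ RC(S − y), Ψ c = −y} φ (reRoot Ψ c)` of the directed corrector transport equals the plain
chart sum `∑ᶠ_{X ∈ RC(S)} φ X`: `(y, Ψ) ↦ reRoot Ψ c` is a bijection onto `RC(S)` with inverse `X ↦ (X ĉ, reRoot X ĉ)`.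
[folklore] -/
theorem tube_corrector_received_identity : ∀ S : Set (EuclideanSpace ℝ (Fin 3)), {X : ℤ × ℤ × ℤ → EuclideanSpace ℝ (Fin 3) | IsRootedChart S X}.Finite → (∀ y ∈ S, {Ψ : ℤ × ℤ × ℤ → EuclideanSpace ℝ (Fin 3) | IsRootedChart ((fun z : EuclideanSpace ℝ (Fin 3) => z - y) '' S) Ψ}.Finite) → ∀ (φ : (ℤ × ℤ × ℤ → EuclideanSpace ℝ (Fin 3)) → ℝ) (c : ℤ × ℤ × ℤ), ∑ᶠ y ∈ S, ∑ᶠ Ψ ∈ {Ψ : ℤ × ℤ × ℤ → EuclideanSpace ℝ (Fin 3) | IsRootedChart ((fun z : EuclideanSpace ℝ (Fin 3) => z - y) '' S) Ψ ∧ Ψ c = -y}, φ (reRoot Ψ c) = ∑ᶠ X ∈ {X : ℤ × ℤ × ℤ → EuclideanSpace ℝ (Fin 3) | IsRootedChart S X}, φ X := by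
  intro S hfin _ φ c
  -- the fibres `A y`, their graph `T`, and the re-rooting map `e`
  let A : EuclideanSpace ℝ (Fin 3) → Set (ℤ × ℤ × ℤ → EuclideanSpace ℝ (Fin 3)) := fun y =>
    {Ψ | IsRootedChart ((fun z : EuclideanSpace ℝ (Fin 3) => z - y) '' S) Ψ ∧ Ψ c = -y}
  let T : Set (EuclideanSpace ℝ (Fin 3) × (ℤ × ℤ × ℤ → EuclideanSpace ℝ (Fin 3))) := {p | p.2 ∈ A p.1}
  let e : EuclideanSpace ℝ (Fin 3) × (ℤ × ℤ × ℤ → EuclideanSpace ℝ (Fin 3)) → (ℤ × ℤ × ℤ → EuclideanSpace ℝ (Fin 3)) :=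
    fun p => reRoot p.2 c
  show ∑ᶠ y ∈ S, ∑ᶠ Ψ ∈ A y, φ (reRoot Ψ c) = ∑ᶠ X ∈ {X | IsRootedChart S X}, φ X
  -- `e` is a bijection from the graph of the fibres onto the rooted charts of `S`
  have hBij : Set.BijOn e T {X | IsRootedChart S X} := by
    refine ⟨?_, ?_, ?_⟩
    · rintro ⟨y, Ψ⟩ ⟨hΨ, hΨc⟩
      exact isRootedChart_reRoot_of_apply_eq_neg hΨ hΨc
    · rintro ⟨y, Ψ⟩ ⟨hΨ, hΨc⟩ ⟨y', Ψ'⟩ ⟨hΨ', hΨ'c⟩ h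
      have key : reRoot Ψ c = reRoot Ψ' c := h
      have hΨΨ' : Ψ = Ψ' := by
        rw [← reRoot_involution' Ψ hΨ.1 c, ← reRoot_involution' Ψ' hΨ'.1 c, key]
      subst hΨΨ'
      have hyy' : y = y' := neg_injective ((hΨc.symm.trans hΨ'c : -y = -y'))
      subst hyy'
      rfl
    · intro X hX
      refine ⟨(X (if Even c.1 then -c else c), reRoot X (if Even c.1 then -c else c)), ⟨?_, ?_⟩, ?_⟩
      · exact tube_reRoot_isRootedChart S X hX _
      · exact reRoot_inv_apply X hX.1 c
      · exact tube_reRoot_involution X hX.1 c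
  -- hence the graph is finite
  have hT : T.Finite := Set.Finite.of_finite_image (hBij.image_eq.symm ▸ hfin) hBij.injOn
  -- the fibre over `y ∉ S` is empty, so the outer restriction to `S` can be dropped
  have hA : ∀ y, y ∉ S → A y = ∅ := fun y hy =>
    Set.eq_empty_of_forall_notMem fun Ψ hΨ => hy (mem_of_isRootedChart_image_sub hΨ.1)
  have h1 : ∑ᶠ y ∈ S, ∑ᶠ Ψ ∈ A y, φ (reRoot Ψ c) = ∑ᶠ y, ∑ᶠ Ψ ∈ A y, φ (reRoot Ψ c) := by
    rw [finsum_mem_def]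
    refine finsum_congr fun y => ?_
    by_cases hy : y ∈ S
    · exact indicator_of_mem hy _
    · rw [indicator_of_notMem hy, hA y hy, finsum_mem_empty]
  -- the iterated sum is the sum over the graph
  have h2 : ∑ᶠ p ∈ T, φ (e p) = ∑ᶠ y, ∑ᶠ Ψ ∈ A y, φ (reRoot Ψ c) := by
    have h := finsum_mem_finset_product hT.toFinset (fun p => φ (e p))
    simp only [Set.Finite.mem_toFinset] at h
    exact h
  rw [h1, ← h2]
  exact finsum_mem_eq_of_bijOn e hBij (fun p _ => rfl)

end Summit.AtomisticToContinuum.Crystallization.Theorems.PalmUnimodularRigidity.LayeredLawsSelectHcp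

end
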